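import Mathlib
import HarnessLib
import Summits.NavierStokesRegularity.NavierStokesRegularity.Theorems.PoloidalWindowDoorPoloidalWindowRigidityZShockSlopeFunctionSourceLocal

/-!
# Crux K2 `PoloidalWindowRigidity` (stmt-NavierStokesRegularity-19708), line `z_shock` — the Aut column as a PASSIVE-SCALAR problem:
# `𝓛[v₂ − G(t,v₂)] = A(t, x₂)` on a space–time box around every slab point off `{∇ₕv₂ = 0}`

`--supports stmt-NavierStokesRegularity-19708 --as helper` (leafhand-ns-poloidalwindowdoor-3 g13, cell decomp-ns, 2026-08-31).  Def-free.
**No stub and no summit is closed by this file; Navier–Stokes regularity is NOT proved here (rung 0).**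

Bridges B1–B3 (`…ZShockSlopeFunctionSpaceTime`, `…ZShockSlopeFunctionPressureLocal`, `…ZShockSlopeFunctionSourceLocal`) give, on the z_shock
Aut column near every slab point off `{∇ₕv₂ = 0}`, a `C^∞` slope antiderivative `G` with the (SF) constraint and the law `∇ₕ a = 0` for
the source `a = (1 − ∂_sG)f₂ − ∂ₜG + ∂_s²G‖∇v₂‖²` of the Clebsch weight `u = v₂ − G(t,v₂)` (`𝓛u = a`, K2-p2's `material_clebschWeight`,
`𝓛 = ∂ₜ + v·∇ − Δ`).  This file integrates `∇ₕ a = 0` along horizontal segments of a ball and packages the result in the format a prover of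
the located residual B4 («height dependence of the source») wants:

* `clebschWeight_transport_of_class_autonomy` — class binders of `stub_zShockThickAut` + its local autonomy clause on an open nonempty `W₁`
  of the slab ⟹ for EVERY `t < 0`, `x` with `∇ₕv₂(t,x) ≠ 0`: a `C^∞` slope antiderivative `G : ℝ → ℝ → ℝ`, a SOURCE `A : ℝ → ℝ → ℝ` of
  TIME AND HEIGHT ONLY, and `r > 0` with the box `B = (t−r,t+r) × B(x,r)` inside the slab, such that on `B` the (SF) constraint
  `∂_z v_b = ∂_sG(s,v₂)∂_b v₂` holds and **`𝓛[v₂ − G(·,v₂)](s,y) = A(s, y₂)`** for every `(s,y) ∈ B`.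

So the open content of the Aut column (hypothesis `hSF` of `…ZShockSFReduction`) reads: a poloidal Type-I ancient mild profile whose
Clebsch weight is, near a thick hyperbolic twisting window point, a passive scalar driven by a `(t, x₂)`-source — exclude it
(`…SlopeFunctionPassive` does so GLOBALLY when the source is height-FREE).  presearch: n/a (tree-internal packaging). [folklore]
-/

noncomputable section

-- the summit and its single sub-problem share the name (CONVENTIONS §1), as in every Theorems file
set_option linter.dupNamespace false

namespace Summit.NavierStokesRegularity.NavierStokesRegularity.Theorems.PoloidalWindowDoorPoloidalWindowRigidityZShockClebschTransport

open MeasureTheory Set Function Filter Topology TopologicalSpace Metric InnerProductSpace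
open scoped RealInnerProductSpace InnerProductSpace Laplacian ContDiff
open Literature.Analysis Literature.Analysis.FluidPDE
open Summit.NavierStokesRegularity.NavierStokesRegularity.Theorems.LocalSineTubeDoorProfileAlignedWindowRigidityAncient
open Summit.NavierStokesRegularity.NavierStokesRegularity.Theorems.PoloidalWindowDoorPoloidalWindowRigidityWindow
open Summit.NavierStokesRegularity.NavierStokesRegularity.Theorems.PoloidalWindowDoorPoloidalWindowRigidityFlat
open Summit.NavierStokesRegularity.NavierStokesRegularity.Theorems.PoloidalWindowDoorPoloidalWindowRigidityVelocityGradientLaw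
open Summit.NavierStokesRegularity.NavierStokesRegularity.Theorems.PoloidalWindowDoorPoloidalWindowRigiditySeparatedPressure
open Summit.NavierStokesRegularity.NavierStokesRegularity.Theorems.PoloidalWindowDoorPoloidalWindowRigidityMaterialLeibniz
open Summit.NavierStokesRegularity.NavierStokesRegularity.Theorems.PoloidalWindowDoorPoloidalWindowRigidityVerticalSourceGauge
open Summit.NavierStokesRegularity.NavierStokesRegularity.Theorems.PoloidalWindowDoorPoloidalWindowRigiditySlopeFunctionPressure
open Summit.NavierStokesRegularity.NavierStokesRegularity.Theorems.PoloidalWindowDoorPoloidalWindowRigiditySlopeFunctionSource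
open Summit.NavierStokesRegularity.NavierStokesRegularity.Theorems.PoloidalWindowDoorPoloidalWindowRigidityZShockSlopeFunctionSourceLocal

variable {C : ℝ} {v : ℝ → EuclideanSpace ℝ (Fin 3) → EuclideanSpace ℝ (Fin 3)}

section Class

variable (hrate : HasTypeITimeDecay C v) (hcont : ContinuousOn (uncurry v) (Iio (0 : ℝ) ×ˢ univ))
  (hmild : ∀ s t : ℝ, s < t → t < 0 → ∀ x,
    v t x = UnboundedOperators.heatExtension (v s) (t - s) x - oseenDuhamel 1 s v v t x)
  (hdiv : ∀ t < 0, VectorCalculus.IsDivFree (v t))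

include hrate hcont hmild hdiv

/-- **The source of the Clebsch weight is differentiable along the slice** (regularity bookkeeping, as inside K2-p2's
`horizFDeriv_clebschSource_eq_zero`): for `G ∈ C³(ℝ²)` and `t < 0`, the slice function
`y ↦ (1 − ∂_sG(t,v₂)) f₂ − ∂ₜG(t,v₂) + ∂_s²G(t,v₂) Σᵢ(∂ᵢv₂)²` is differentiable at every point. [folklore] -/
theorem differentiableAt_clebschSource {G : ℝ → ℝ → ℝ} (hG : ContDiff ℝ 3 (uncurry G)) {t : ℝ} (ht : t < 0)
    (x : EuclideanSpace ℝ (Fin 3)) :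
    DifferentiableAt ℝ (fun y =>
      (1 - deriv (G t) (v t y 2)) * (timeDerivWithin (Iio 0) v t y + convect (v t) (v t) y - Δ (v t) y) 2
        - deriv (fun τ => G τ (v t y 2)) t
        + deriv (deriv (G t)) (v t y 2) * ∑ i : Fin 3, fderiv ℝ (v t) y (EuclideanSpace.single i 1) 2 ^ 2) x := by
  have hG2 : ContDiff ℝ 2 (uncurry G) := hG.of_le (by norm_cast)
  have hGd : ∀ p, DifferentiableAt ℝ (uncurry G) p := fun p => (hG2.differentiable (by norm_num)) p
  have hθ : ContDiff ℝ ∞ (fun y => v t y 2) := contDiff_vert_slice hrate hcont hmild hdiv ht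
  have hθd : DifferentiableAt ℝ (fun y => v t y 2) x := (hθ.differentiable (by simp)) x
  have hGt3 : ContDiff ℝ 3 (G t) := hG.comp (contDiff_const.prodMk contDiff_id)
  have hG'2 : ContDiff ℝ 2 (deriv (G t)) := (contDiff_succ_iff_deriv.1 (hGt3 : ContDiff ℝ ((2 : ℕ∞) + 1 : ℕ∞) (G t))).2.2
  have hG''1 : ContDiff ℝ 1 (deriv (deriv (G t))) :=
    (contDiff_succ_iff_deriv.1 (hG'2 : ContDiff ℝ ((1 : ℕ∞) + 1 : ℕ∞) (deriv (G t)))).2.2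
  have hR := differentiableAt_residual hrate hcont hmild hdiv ht x
  have hF2 : DifferentiableAt ℝ
      (fun y => (timeDerivWithin (Iio 0) v t y + convect (v t) (v t) y - Δ (v t) y) 2) x :=
    ((EuclideanSpace.proj (𝕜 := ℝ) (2 : Fin 3) : EuclideanSpace ℝ (Fin 3) →L[ℝ] ℝ).differentiableAt).comp x hR
  have hEntd : ∀ i : Fin 3, DifferentiableAt ℝ (fun y => fderiv ℝ (v t) y (EuclideanSpace.single i 1) 2) x :=
    fun i => ((contDiff_fderiv_coord hrate hcont hmild hdiv ht (EuclideanSpace.single i 1) 2).differentiable (by simp)) x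
  have hQd : DifferentiableAt ℝ (fun y => ∑ i : Fin 3, fderiv ℝ (v t) y (EuclideanSpace.single i 1) 2 ^ 2) x :=
    DifferentiableAt.fun_sum fun i _ => (hEntd i).pow 2
  have hA1 : DifferentiableAt ℝ (fun y => deriv (G t) (v t y 2)) x :=
    ((hG'2.differentiable (by norm_num)) _).comp x hθd
  have hA2 : DifferentiableAt ℝ (fun y => deriv (deriv (G t)) (v t y 2)) x :=
    ((hG''1.differentiable (by norm_num)) _).comp x hθd
  obtain ⟨Gt, hGt⟩ : ∃ Gt : ℝ → ℝ, ∀ σ, Gt σ = deriv (fun τ => G τ σ) t := ⟨_, fun _ => rfl⟩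
  have hGt_eq : Gt = fun σ => fderiv ℝ (uncurry G) (t, σ) (1, 0) :=
    funext fun σ => by rw [hGt]; exact (hasDerivAt_slices_of_uncurry (hGd (t, σ))).2.deriv
  have hGt2 : ContDiff ℝ 2 Gt := by
    rw [hGt_eq]
    exact ((hG.fderiv_right (m := 2) (by norm_cast)).clm_apply contDiff_const).comp
      (contDiff_const.prodMk contDiff_id)
  have hB : DifferentiableAt ℝ (fun y => deriv (fun τ => G τ (v t y 2)) t) x := by
    have e : (fun y => deriv (fun τ => G τ (v t y 2)) t) = fun y => Gt (v t y 2) := funext fun y => (hGt _).symm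
    rw [e]
    exact ((hGt2.differentiable (by norm_num)) _).comp x hθd
  exact (((hA1.const_sub 1).mul hF2).sub hB).add (hA2.mul hQd)

/-- ★ **The Aut column as a passive-scalar problem.**  Class binders of `stub_zShockThickAut` (Type-I rate, continuity, Oseen identity,
divergence-free, poloidal) + the stub's LOCAL autonomy clause on an open nonempty `W₁` of the backward slab.  Then at EVERY `t < 0` and
EVERY `x` with `∇ₕv₂(t,x) ≠ 0` there are a jointly `C^∞` slope antiderivative `G : ℝ → ℝ → ℝ`, a source `A : ℝ → ℝ → ℝ` of TIME AND
HEIGHT ONLY and `r > 0` such that the box `(t−r,t+r) × B(x,r)` lies in the slab, carries the (SF) constraint `∂_z v_b = ∂_sG(s,v₂)∂_b v₂`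
(both `b ≠ 2`), and on it the Clebsch weight `u = v₂ − G(·,v₂)` is a PASSIVE SCALAR:
`∂ₛu + v·∇u − Δu = A(s, y₂)` at every `(s, y)` of the box. [folklore] -/
theorem clebschWeight_transport_of_class_autonomy
    (hpol : ∀ s < 0, ∀ y, ⟪curl (v s) y, EuclideanSpace.single 2 1⟫_ℝ = 0)
    {W₁ : Set (ℝ × EuclideanSpace ℝ (Fin 3))} (hW₁ : IsOpen W₁) (hW₁s : W₁ ⊆ Set.Iio (0 : ℝ) ×ˢ Set.univ)
    (hW₁ne : W₁.Nonempty) {g : ℝ → ℝ → ℝ}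
    (haut : ∀ z ∈ W₁, ∀ b : Fin 3, b ≠ 2 →
      fderiv ℝ (v z.1) z.2 (EuclideanSpace.single 2 1) b =
        g z.1 (v z.1 z.2 2) * fderiv ℝ (v z.1) z.2 (EuclideanSpace.single b 1) 2)
    {t : ℝ} (ht : t < 0) {x : EuclideanSpace ℝ (Fin 3)}
    (hx : fderiv ℝ (v t) x (EuclideanSpace.single 0 1) 2 ≠ 0 ∨ fderiv ℝ (v t) x (EuclideanSpace.single 1 1) 2 ≠ 0) :
    ∃ G : ℝ → ℝ → ℝ, ContDiff ℝ ∞ (uncurry G) ∧ ∃ A : ℝ → ℝ → ℝ, ∃ r > (0 : ℝ),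
      Metric.ball t r ×ˢ Metric.ball x r ⊆ Set.Iio (0 : ℝ) ×ˢ Set.univ ∧
      (∀ z ∈ Metric.ball t r ×ˢ Metric.ball x r, ∀ b : Fin 3, b ≠ 2 →
        fderiv ℝ (v z.1) z.2 (EuclideanSpace.single 2 1) b =
          deriv (G z.1) (v z.1 z.2 2) * fderiv ℝ (v z.1) z.2 (EuclideanSpace.single b 1) 2) ∧
      ∀ z ∈ Metric.ball t r ×ˢ Metric.ball x r,
        deriv (fun s => v s z.2 2 - G s (v s z.2 2)) z.1
            + fderiv ℝ (fun y => v z.1 y 2 - G z.1 (v z.1 y 2)) z.2 (v z.1 z.2)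
            - Δ (fun y => v z.1 y 2 - G z.1 (v z.1 y 2)) z.2 = A z.1 (z.2 2) := by
  obtain ⟨G, hGc, O, hOo, hxO, hOs, hslope, hsrc⟩ :=
    clebschSource_horizConst_of_class_autonomy hrate hcont hmild hdiv hpol hW₁ hW₁s hW₁ne haut ht hx
  have hG3 : ContDiff ℝ 3 (uncurry G) := hGc.of_le (by norm_cast)
  have hG2 : ContDiff ℝ 2 (uncurry G) := hGc.of_le (by norm_cast)
  -- an opaque name for the source
  obtain ⟨src, hsrcdef⟩ : ∃ src : ℝ → EuclideanSpace ℝ (Fin 3) → ℝ, ∀ s y, src s y =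
      (1 - deriv (G s) (v s y 2)) * (timeDerivWithin (Iio 0) v s y + convect (v s) (v s) y - Δ (v s) y) 2
        - deriv (fun τ => G τ (v s y 2)) s
        + deriv (deriv (G s)) (v s y 2) * ∑ i : Fin 3, fderiv ℝ (v s) y (EuclideanSpace.single i 1) 2 ^ 2 :=
    ⟨_, fun _ _ => rfl⟩
  have hsrcfun : ∀ s, src s = fun y =>
      (1 - deriv (G s) (v s y 2)) * (timeDerivWithin (Iio 0) v s y + convect (v s) (v s) y - Δ (v s) y) 2
        - deriv (fun τ => G τ (v s y 2)) s
        + deriv (deriv (G s)) (v s y 2) * ∑ i : Fin 3, fderiv ℝ (v s) y (EuclideanSpace.single i 1) 2 ^ 2 :=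
    fun s => funext (hsrcdef s)
  -- a product box inside `O`
  obtain ⟨r, hr, hball⟩ := Metric.isOpen_iff.1 hOo (t, x) hxO
  have hbox : Metric.ball t r ×ˢ Metric.ball x r ⊆ O := by
    rw [ball_prod_same]; exact hball
  -- on `O`: horizontal derivatives of the source vanish, and the source is differentiable
  have hhor : ∀ (s : ℝ) (p : EuclideanSpace ℝ (Fin 3)), (s, p) ∈ O → ∀ b : Fin 3, b ≠ 2 →
      fderiv ℝ (src s) p (EuclideanSpace.single b 1) = 0 := by
    intro s p hz b hb
    rw [hsrcfun s]
    exact hsrc (s, p) hz b hb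
  have hsd : ∀ (s : ℝ) (p : EuclideanSpace ℝ (Fin 3)), (s, p) ∈ O → DifferentiableAt ℝ (src s) p := by
    intro s p hz
    rw [hsrcfun s]
    exact differentiableAt_clebschSource hrate hcont hmild hdiv hG3 (Set.mem_prod.1 (hOs hz)).1 p
  -- the source is constant along horizontal segments of the box
  set e₂ : EuclideanSpace ℝ (Fin 3) := EuclideanSpace.single 2 1 with he₂
  have hkey : ∀ s ∈ Metric.ball t r, ∀ y ∈ Metric.ball x r, src s y = src s (x + (y 2 - x 2) • e₂) := by
    intro s hs y hy
    set q : EuclideanSpace ℝ (Fin 3) := x + (y 2 - x 2) • e₂ with hq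
    -- the foot point `q` lies in the ball
    have hqball : q ∈ Metric.ball x r := by
      rw [Metric.mem_ball, dist_eq_norm]
      have e1 : q - x = (y 2 - x 2) • e₂ := by rw [hq]; abel
      have hn : ‖q - x‖ = ‖y 2 - x 2‖ := by
        rw [e1, norm_smul]
        simp [he₂]
      rw [hn]
      have h2 : ‖(y - x) 2‖ ≤ ‖y - x‖ := PiLp.norm_apply_le (y - x) 2
      have h3 : (y - x) 2 = y 2 - x 2 := by simp
      rw [h3] at h2
      exact lt_of_le_of_lt h2 (by rwa [Metric.mem_ball, dist_eq_norm] at hy)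
    -- the horizontal direction `d = y - q`
    set d : EuclideanSpace ℝ (Fin 3) := y - q with hd
    have hd2 : d 2 = 0 := by simp [hd, hq, he₂]
    have hdec : d = d 0 • EuclideanSpace.single 0 (1 : ℝ) + d 1 • EuclideanSpace.single 1 (1 : ℝ) := by
      ext i
      fin_cases i <;> simp [hd2]
    -- the segment from `q` to `y` stays in the ball, hence in `O` at time `s`
    have hseg : ∀ σ ∈ Icc (0 : ℝ) 1, q + σ • d ∈ Metric.ball x r := by
      intro σ hσ
      have h := (convex_ball x r).add_smul_sub_mem hqball hy hσ
      simpa [hd] using h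
    have hderiv : ∀ σ ∈ Icc (0 : ℝ) 1, HasDerivAt (fun σ : ℝ => src s (q + σ • d)) 0 σ := by
      intro σ hσ
      have hO' : (s, q + σ • d) ∈ O := hbox (Set.mk_mem_prod hs (hseg σ hσ))
      have h1 : HasDerivAt (fun σ : ℝ => q + σ • d) d σ := by
        simpa using ((hasDerivAt_id σ).smul_const d).const_add q
      have h2 : HasDerivAt (fun σ : ℝ => src s (q + σ • d)) (fderiv ℝ (src s) (q + σ • d) d) σ :=
        (hsd s (q + σ • d) hO').hasFDerivAt.comp_hasDerivAt σ h1
      have hz : fderiv ℝ (src s) (q + σ • d) d = 0 := by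
        have e := congrArg (fderiv ℝ (src s) (q + σ • d)) hdec
        rw [e, map_add, map_smul, map_smul, hhor s (q + σ • d) hO' 0 (by decide),
          hhor s (q + σ • d) hO' 1 (by decide), smul_zero, smul_zero, add_zero]
      rwa [hz] at h2
    have h := constant_of_has_deriv_right_zero (f := fun σ : ℝ => src s (q + σ • d)) (a := 0) (b := 1)
      (fun σ hσ => (hderiv σ hσ).continuousAt.continuousWithinAt)
      (fun σ hσ => (hderiv σ (Ico_subset_Icc_self hσ)).hasDerivWithinAt) 1 (right_mem_Icc.2 zero_le_one)
    have e1 : q + (1 : ℝ) • d = y := by rw [one_smul, hd]; abel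
    have e0 : q + (0 : ℝ) • d = q := by rw [zero_smul, add_zero]
    rw [e1, e0] at h
    exact h
  -- ## package
  refine ⟨G, hGc, fun s ζ => src s (x + (ζ - x 2) • e₂), r, hr, hbox.trans hOs,
    fun z hz b hb => hslope z (hbox hz) b hb, fun z hz => ?_⟩
  obtain ⟨hz1, hz2⟩ := Set.mem_prod.1 hz
  have hs0 : z.1 < 0 := (Set.mem_prod.1 (hOs (hbox hz))).1
  rw [material_clebschWeight hrate hcont hmild hdiv hG2 hs0 z.2, ← hsrcdef z.1 z.2]
  exact hkey z.1 hz1 z.2 hz2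

end Class

end Summit.NavierStokesRegularity.NavierStokesRegularity.Theorems.PoloidalWindowDoorPoloidalWindowRigidityZShockClebschTransport

end
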